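import Mathlib
import Summits.ResolutionOfSingularities.ResolutionOfSingularities.Theorems.HomologicalConductorPersistencePointedCycles
import HarnessLib

/-!
# Rung S-2 `PersistenceSurface` (stmt-ResolutionOfSingularities-19970) — POINTED CYCLES IV: from an embedded
# `A_ℓ`-path to the pyramid (memo K-PCC Cor 4.4, lattice glue; res-L1-w44b-lead-1 g4)

Route `ResolutionOfSingularities/HomologicalConductor`, chain W4.4b, rung S-2 `PersistenceSurface` (stmt-19970), stub C3′ /
local core.  `[OURS · L1 w44b]`; replaces the role of no printed item; NOT a statement of the manuscript under review
(Hironaka 2017); AI-written elementary arithmetic, weaker than expert review.  Def-free; sequel of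
`…PersistencePointedCycles` (p564614), whose PYRAMID LEMMA is stated for an abstract profile `W : ℕ → ℤ`.

## What this file adds
The glue between the two shapes: a path `C_{e 1} — ⋯ — C_{e ℓ}` of (−2)-curves INSIDE a configuration `ι` with
intersection matrix `M` (non-negative off the diagonal): `M (e k) (e k) = −2`, consecutive curves meet once
(`M (e k) (e (k+1)) = M (e (k+1)) (e k) = 1`), non-consecutive path curves are disjoint, `e` injective on `1..ℓ`.  For an
effective cycle `W : ι → ℕ` (supported anywhere) satisfying the pointed anti-nef inequalities AT THE PATH CURVES with
corner at `e m` (`W·C_{e k} ≤ −δ_{k m}`), the profile `k ↦ W (e k)` (virtual zeros at `0` and `ℓ+1`) is concave with a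
strict corner at `m`: the curves off the path only ADD non-negative terms to `W·C_{e k}`
(`sum_path_le_pairing`).  Hence (`pyramid_le_apply_path`, via p564614 `pyramid_le_of_concave_of_corner`) for a middle
index `m` (`ℓ ≤ 2m ≤ ℓ+2`): **`min(k, ℓ+1−k) ≤ W (e k)` for `1 ≤ k ≤ ℓ`** — the `A_ℓ` threshold (`ca(A_ℓ) = (u,v,w^⌈ℓ/2⌉)`).
With the restriction lemma of p564614 this is the complete lattice side of K-PCC Cor 4.4: every cycle of `𝒫_{e m}(Γ)`
dominates the pyramid on an `A_ℓ`-path through its middle curve `e m`.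

References (mechanism only): this work (memo K-PCC, evidence on stmt-19970); Artin 1966 / Lipman 1969 §18 for the setting.
-/

-- single-problem summit: the doubled namespace component `ResolutionOfSingularities` is forced
set_option linter.dupNamespace false

namespace Summit.ResolutionOfSingularities.ResolutionOfSingularities.Theorems.HomologicalConductor.PersistencePointedCyclesPath

open Finset
open Summit.ResolutionOfSingularities.ResolutionOfSingularities.Theorems.HomologicalConductor.PersistencePointedCycles
  (pyramid_le_of_concave_of_corner)

variable {ι : Type*} [Fintype ι] [DecidableEq ι]

omit [DecidableEq ι] in
/-- **Dropping the off-path terms.** If `M` is non-negative off the diagonal and `W ≥ 0`, then for a finite set `F`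
containing `i`, `Σ_{j∈F} W_j M j i ≤ Σ_j W_j M j i = W·C_i` (the dropped terms `j ∉ F`, `j ≠ i`, are `≥ 0`). [folklore] -/
theorem sum_subset_le_pairing (M : ι → ι → ℤ) (hoff : ∀ i j, i ≠ j → 0 ≤ M i j) (W : ι → ℕ) (i : ι)
    (F : Finset ι) (hi : i ∈ F) : ∑ j ∈ F, (W j : ℤ) * M j i ≤ ∑ j, (W j : ℤ) * M j i := by
  refine sum_le_sum_of_subset_of_nonneg (subset_univ F) fun j _ hj => ?_
  exact mul_nonneg (Nat.cast_nonneg _) (hoff j i fun h => hj (h ▸ hi))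

/-- **The path inequality.** For a path of (−2)-curves `e 1, …, e ℓ` as in the module docstring and `1 ≤ k ≤ ℓ`:
`W(e(k−1)) − 2·W(e k) + W(e(k+1)) ≤ W·C_{e k}`, where the profile is read with virtual zeros outside `1..ℓ`
(`w k' = W (e k')` for `1 ≤ k' ≤ ℓ`, else `0`). [this work] -/
theorem sum_path_le_pairing (M : ι → ι → ℤ) (hoff : ∀ i j, i ≠ j → 0 ≤ M i j) (ℓ : ℕ) (e : ℕ → ι)
    (hinj : ∀ a b, 1 ≤ a → a ≤ ℓ → 1 ≤ b → b ≤ ℓ → e a = e b → a = b)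
    (hdiag : ∀ k, 1 ≤ k → k ≤ ℓ → M (e k) (e k) = -2)
    (hadj : ∀ k, 1 ≤ k → k + 1 ≤ ℓ → M (e k) (e (k + 1)) = 1 ∧ M (e (k + 1)) (e k) = 1)
    (W : ι → ℕ) (k : ℕ) (hk1 : 1 ≤ k) (hk2 : k ≤ ℓ) :
    (if 1 ≤ k - 1 then (W (e (k - 1)) : ℤ) else 0) - 2 * (W (e k) : ℤ)
        + (if k + 1 ≤ ℓ then (W (e (k + 1)) : ℤ) else 0) ≤ ∑ j, (W j : ℤ) * M j (e k) := by
  -- the set of path neighbours of `e k` inside `1..ℓ`, together with `e k`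
  by_cases hlo : 1 ≤ k - 1 <;> by_cases hhi : k + 1 ≤ ℓ <;> simp only [hlo, hhi, if_true, if_false]
  · -- both neighbours present
    have hne1 : e (k - 1) ≠ e k := fun h => by have := hinj _ _ hlo (by omega) hk1 hk2 h; omega
    have hne2 : e (k + 1) ≠ e k := fun h => by have := hinj _ _ (by omega) hhi hk1 hk2 h; omega
    have hne3 : e (k - 1) ≠ e (k + 1) := fun h => by have := hinj _ _ hlo (by omega) (by omega) hhi h; omega
    have h := sum_subset_le_pairing M hoff W (e k) {e (k - 1), e k, e (k + 1)} (by simp)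
    rw [sum_insert (by simp [hne1, hne3]), sum_insert (by simp [hne2.symm]), sum_singleton] at h
    have h1 : M (e (k - 1)) (e k) = 1 := by
      have := (hadj (k - 1) hlo (by omega)).1; rwa [show k - 1 + 1 = k by omega] at this
    have h2 : M (e (k + 1)) (e k) = 1 := (hadj k hk1 hhi).2
    rw [h1, h2, hdiag k hk1 hk2] at h
    linarith
  · -- only the left neighbour
    have hne1 : e (k - 1) ≠ e k := fun h => by have := hinj _ _ hlo (by omega) hk1 hk2 h; omega
    have h := sum_subset_le_pairing M hoff W (e k) {e (k - 1), e k} (by simp)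
    rw [sum_insert (by simp [hne1]), sum_singleton] at h
    have h1 : M (e (k - 1)) (e k) = 1 := by
      have := (hadj (k - 1) hlo (by omega)).1; rwa [show k - 1 + 1 = k by omega] at this
    rw [h1, hdiag k hk1 hk2] at h
    linarith
  · -- only the right neighbour
    have hne2 : e (k + 1) ≠ e k := fun h => by have := hinj _ _ (by omega) hhi hk1 hk2 h; omega
    have h := sum_subset_le_pairing M hoff W (e k) {e (k + 1), e k} (by simp)
    rw [sum_insert (by simp [hne2]), sum_singleton] at h
    rw [(hadj k hk1 hhi).2, hdiag k hk1 hk2] at h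
    linarith
  · -- isolated curve (ℓ = 1)
    have h := sum_subset_le_pairing M hoff W (e k) {e k} (by simp)
    rw [sum_singleton, hdiag k hk1 hk2] at h
    linarith

/-- **From an embedded `A_ℓ`-path to the pyramid** (memo K-PCC Cor 4.4, lattice side).  Let `e 1,…,e ℓ` be a path of
(−2)-curves in the configuration `ι` (injective; self-intersection `−2`; consecutive curves meet once; `M ≥ 0` off the
diagonal — non-consecutive path curves and all other curves then only contribute non-negative terms), `m` a middle
index (`ℓ ≤ 2m ≤ ℓ+2`), and `W : ι → ℕ` an effective cycle with `W·C_{e k} ≤ −δ_{k m}` for `1 ≤ k ≤ ℓ` (e.g. any member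
of `𝒫_{e m}(Γ)`, or its restriction to the path).  Then `min(k, ℓ+1−k) ≤ W (e k)` for every `1 ≤ k ≤ ℓ`: the profile on
the path dominates the cycle of `ca(A_ℓ) = (u, v, w^{⌈ℓ/2⌉})`. [this work] -/
theorem pyramid_le_apply_path (M : ι → ι → ℤ) (hoff : ∀ i j, i ≠ j → 0 ≤ M i j) (ℓ m : ℕ) (e : ℕ → ι)
    (hinj : ∀ a b, 1 ≤ a → a ≤ ℓ → 1 ≤ b → b ≤ ℓ → e a = e b → a = b)
    (hdiag : ∀ k, 1 ≤ k → k ≤ ℓ → M (e k) (e k) = -2)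
    (hadj : ∀ k, 1 ≤ k → k + 1 ≤ ℓ → M (e k) (e (k + 1)) = 1 ∧ M (e (k + 1)) (e k) = 1)
    (hm1 : 1 ≤ m) (hm2 : m ≤ ℓ) (hmid1 : ℓ ≤ 2 * m) (hmid2 : 2 * m ≤ ℓ + 2)
    (W : ι → ℕ) (hW : ∀ k, 1 ≤ k → k ≤ ℓ → ∑ j, (W j : ℤ) * M j (e k) ≤ -(if k = m then 1 else 0)) :
    ∀ k, 1 ≤ k → k ≤ ℓ → ((min k (ℓ + 1 - k) : ℕ) : ℤ) ≤ W (e k) := by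
  -- the profile with virtual zeros off `1..ℓ`
  set w : ℕ → ℤ := fun k => if 1 ≤ k ∧ k ≤ ℓ then (W (e k) : ℤ) else 0 with hw
  have hw_in : ∀ k, 1 ≤ k → k ≤ ℓ → w k = W (e k) := fun k h1 h2 => by simp [hw, h1, h2]
  have hw0 : w 0 = 0 := by simp [hw]
  have hwl : w (ℓ + 1) = 0 := by simp [hw]
  -- second differences from the path inequality
  have hsd : ∀ k, 1 ≤ k → k ≤ ℓ → w (k - 1) + w (k + 1) ≤ 2 * w k - (if k = m then 1 else 0) := by
    intro k hk1 hk2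
    have hp := sum_path_le_pairing M hoff ℓ e hinj hdiag hadj W k hk1 hk2
    have hq := hW k hk1 hk2
    have hl : w (k - 1) = (if 1 ≤ k - 1 then (W (e (k - 1)) : ℤ) else 0) := by
      by_cases h : 1 ≤ k - 1
      · rw [hw_in (k - 1) h (by omega)]; simp [h]
      · have : k - 1 = 0 := by omega
        rw [this, hw0]; simp
    have hr : w (k + 1) = (if k + 1 ≤ ℓ then (W (e (k + 1)) : ℤ) else 0) := by
      by_cases h : k + 1 ≤ ℓ
      · rw [hw_in (k + 1) (by omega) h]; simp [h]
      · have : k + 1 = ℓ + 1 := by omega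
        rw [this, hwl]; simp [show ¬ (ℓ + 1 ≤ ℓ) by omega]
    rw [hl, hr, hw_in k hk1 hk2]
    linarith
  have hconc : ∀ k, 1 ≤ k → k ≤ ℓ → w (k - 1) + w (k + 1) ≤ 2 * w k := fun k h1 h2 => by
    have := hsd k h1 h2; split_ifs at this <;> linarith
  have hcorner : w (m - 1) + w (m + 1) ≤ 2 * w m - 1 := by
    have := hsd m hm1 hm2; simpa using this
  intro k hk1 hk2
  have h := pyramid_le_of_concave_of_corner ℓ m w (by rw [hw0]) (by rw [hwl]) hm1 hm2 hmid1 hmid2 hconc hcorner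
    k hk1 hk2
  rwa [hw_in k hk1 hk2] at h

/-- **Lattice form of K-PCC Cor 4.4 (the shape the sheaf half consumes).**  If the order cycle `ord` of the generator
(`ord i = v_{C_i}(x)`) dominates SOME effective cycle `Z` satisfying the pointed anti-nef inequalities at the curves of an
embedded `A_ℓ`-path with corner at its middle curve `e m` — in K-PCC: `ord ≥ Z⁽ᵉᵐ⁾_Γ − A⁽ᵉᵐ⁾_Γ = Z⁽ᵉᵐ⁾_Γ` by the
pointed ceiling (`…PointedCyclesDefinite.least_sub_greatest_le_add`) and NP(e m), and `Z⁽ᵉᵐ⁾_Γ ∈ 𝒫_{e m}(Γ)` — then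
`ord` dominates the pyramid on the path: `min(k, ℓ+1−k) ≤ ord (e k)`, i.e. `x ∈ I_W(pyramid) = ca(A_ℓ)` at the `A_ℓ`
arrival (appended by res-L1-w44b-lead-1 g4). [this work] -/
theorem pyramid_le_of_dominates_pointed (M : ι → ι → ℤ) (hoff : ∀ i j, i ≠ j → 0 ≤ M i j) (ℓ m : ℕ) (e : ℕ → ι)
    (hinj : ∀ a b, 1 ≤ a → a ≤ ℓ → 1 ≤ b → b ≤ ℓ → e a = e b → a = b)
    (hdiag : ∀ k, 1 ≤ k → k ≤ ℓ → M (e k) (e k) = -2)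
    (hadj : ∀ k, 1 ≤ k → k + 1 ≤ ℓ → M (e k) (e (k + 1)) = 1 ∧ M (e (k + 1)) (e k) = 1)
    (hm1 : 1 ≤ m) (hm2 : m ≤ ℓ) (hmid1 : ℓ ≤ 2 * m) (hmid2 : 2 * m ≤ ℓ + 2)
    (Z : ι → ℕ) (hZ : ∀ i, ∑ j, (Z j : ℤ) * M j i ≤ -(if i = e m then 1 else 0))
    (ord : ι → ℤ) (hord : ∀ i, (Z i : ℤ) ≤ ord i) :
    ∀ k, 1 ≤ k → k ≤ ℓ → ((min k (ℓ + 1 - k) : ℕ) : ℤ) ≤ ord (e k) := by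
  have hW : ∀ k, 1 ≤ k → k ≤ ℓ → ∑ j, (Z j : ℤ) * M j (e k) ≤ -(if k = m then 1 else 0) := by
    intro k hk1 hk2
    have h := hZ (e k)
    have hiff : (e k = e m) ↔ (k = m) :=
      ⟨fun h' => hinj k m hk1 hk2 hm1 hm2 h', fun h' => by rw [h']⟩
    simp only [hiff] at h
    exact h
  intro k hk1 hk2
  exact (pyramid_le_apply_path M hoff ℓ m e hinj hdiag hadj hm1 hm2 hmid1 hmid2 Z hW k hk1 hk2).trans (hord (e k))

end Summit.ResolutionOfSingularities.ResolutionOfSingularities.Theorems.HomologicalConductor.PersistencePointedCyclesPath
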